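import Summits.QuantumAdvantage.QuantumAdvantage.Theorems.CubicForrelationNearExactIsExactCubicFormR4Cells
import Summits.QuantumAdvantage.QuantumAdvantage.Theorems.CubicForrelationNearExactIsExactCubicFormRadical

/-!
# Crux `CubicForrelation.NearExactIsExact` (stmt-QuantumAdvantage-14043) — E1280-even, R4 branch, descendant `T` (`HL 1`): FLAT CELLS
  (cells whose second differences along the free block vanish) and small tools

Certificate seat `b2b-cforr-cert` (gen 43).  HONEST FRAMING: kernel-checked elementary lemmas (standard axioms) for the descendant
`t̄₇ = T = s₀s₁s₂` of …CubicFormR4PartnerDispatch (`HL 1`), replacing the menu (MT) of R4-PARTNER.md §2/§5 by what the Lean route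
actually needs.  For `f : 𝔽₂^{1+6} → 𝔽₂` with third differences `u₀·ω(v,w) ⊕ v₀·ω(u,w) ⊕ w₀·ω(u,v)` (`ω = Σ s_{lo i} ∧ s_{hi i}`) and a
vector `U` supported OFF the coordinates `0, 1+lo i, 1+hi i` ("free" vector): second differences along `(U, ·)` are base-point free
(`tq1_second_free`) and additive in the free slot (`tq1_second_add`); if they vanish at `0` then `D_U f` is constant (`tq1_deriv_const`);
a constant `D_U f = 1` makes `f` balanced, `64` ones (`tq1_flip_card`); `tq1_second_smul`: scaling the free slot by a bit.  `tq1_const_of_units`: invariance under all unit translations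
is constancy.  Nothing about `θ₁₂`; NOT summit progress.

References: this seat lineage (g37 R4-PARTNER §5, g39 HANDPROOFS §2.2–2.3).  Axioms: the standard three.
-/

set_option linter.dupNamespace false -- D-0017: single-problem summit ⇒ `QuantumAdvantage.QuantumAdvantage` by design

namespace Summit.QuantumAdvantage.QuantumAdvantage.Theorems.CubicForrelation.NearExactIsExact

open Finset
open Literature.Computability.QuantumComplexity
open Literature.Computability.QuantumComplexity.BuzetChailloux (bxor zeroVec bxor_comm bxor_self bxor_zeroVec zeroVec_bxor
  bxor_bxor_cancel_left)

/-- **Invariance under unit translations is constancy.** [folklore] -/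
theorem tq1_const_of_units {n : ℕ} (G : (Fin n → Bool) → Bool) (h : ∀ (x : Fin n → Bool) (j : Fin n), G (bxor x (fun l => decide (l = j))) = G x) :
    ∀ x, G x = G zeroVec := by
  suffices H : ∀ (k : ℕ) (x : Fin n → Bool), #(univ.filter fun j => x j = true) ≤ k → G x = G zeroVec from
    fun x => H _ x le_rfl
  intro k
  induction k with
  | zero =>
    intro x hx
    have hx0 : x = zeroVec := by
      funext j
      have hj : j ∉ (univ.filter fun j => x j = true) := by
        rw [Nat.le_zero, card_eq_zero] at hx
        rw [hx]; exact notMem_empty j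
      cases e : x j
      · rfl
      · exact (hj (mem_filter.mpr ⟨mem_univ j, e⟩)).elim
    rw [hx0]
  | succ k ih =>
    intro x hx
    by_cases hx0 : ∃ j, x j = true
    · obtain ⟨j, hj⟩ := hx0
      have ex : x = bxor (bxor x (fun l => decide (l = j))) (fun l => decide (l = j)) := by
        funext l; simp [bxor]
      rw [ex, h]
      apply ih
      have hsub : (univ.filter fun l => bxor x (fun l => decide (l = j)) l = true) = (univ.filter fun l => x l = true).erase j := by
        ext l
        simp only [mem_filter, mem_univ, true_and, mem_erase, bxor]
        by_cases hl : l = j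
        · subst hl; simp [hj]
        · simp [hl]
      have hmem : j ∈ (univ.filter fun l => x l = true) := mem_filter.mpr ⟨mem_univ j, hj⟩
      rw [hsub, card_erase_of_mem hmem]
      omega
    · push Not at hx0
      have : x = zeroVec := by funext j; show x j = false; simpa using hx0 j
      rw [this]

/-- **Scaling the first slot of a second difference at `0` by a bit.** [folklore] -/
theorem tq1_second_smul {n : ℕ} (f : (Fin n → Bool) → Bool) (b : Bool) (U k : Fin n → Bool) :
    ((f zeroVec ^^ f k) ^^ (f (fun l => b && U l) ^^ f (bxor (fun l => b && U l) k))) =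
      (b && ((f zeroVec ^^ f k) ^^ (f U ^^ f (bxor U k)))) := by
  cases b
  · rw [tcf_smul_false, zeroVec_bxor, Bool.false_and]
    cases f zeroVec <;> cases f k <;> rfl
  · rw [tcf_smul_true, Bool.true_and]

section Cells

variable (f : (Fin (1 + 6) → Bool) → Bool) (h : ℕ) (lo hi : Fin h → Fin 6) (ω' : (Fin 6 → Bool) → (Fin 6 → Bool) → Bool)
  (hω' : ∀ v w, ω' v w = decide ((∑ i : Fin h, ((if v (lo i) = true then (1 : ZMod 2) else 0) * (if w (hi i) = true then (1 : ZMod 2) else 0) +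
      (if v (hi i) = true then (1 : ZMod 2) else 0) * (if w (lo i) = true then (1 : ZMod 2) else 0))) = 1))
  (hT : ∀ u v w x : Fin (1 + 6) → Bool,
    (((f x ^^ f (bxor x w)) ^^ (f (bxor x v) ^^ f (bxor (bxor x v) w))) ^^
        ((f (bxor x u) ^^ f (bxor (bxor x u) w)) ^^ (f (bxor (bxor x u) v) ^^ f (bxor (bxor (bxor x u) v) w)))) =
      (((u (Fin.castAdd 6 (0 : Fin 1)) && ω' (fun j => v (Fin.natAdd 1 j)) (fun j => w (Fin.natAdd 1 j))) ^^
          (v (Fin.castAdd 6 (0 : Fin 1)) && ω' (fun j => u (Fin.natAdd 1 j)) (fun j => w (Fin.natAdd 1 j)))) ^^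
        (w (Fin.castAdd 6 (0 : Fin 1)) && ω' (fun j => u (Fin.natAdd 1 j)) (fun j => v (Fin.natAdd 1 j)))))
  (U : Fin (1 + 6) → Bool) (hU0 : U (Fin.castAdd 6 (0 : Fin 1)) = false)
  (hUlo : ∀ i, U (Fin.natAdd 1 (lo i)) = false) (hUhi : ∀ i, U (Fin.natAdd 1 (hi i)) = false)
include hω' hT hU0 hUlo hUhi

/-- **Second differences along a free vector are base-point free.**  If `U` vanishes on the coordinates `0`, `1 + lo i`, `1 + hi i`, then
for every `k` the second difference of `f` along `(U, k)` does not depend on the base point (the third difference `(x, U, k)` vanishes: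
every term of the normal form carries a factor `U₀` or an `ω`-pairing of `U`). [this work] -/
theorem tq1_second_free (k x : Fin (1 + 6) → Bool) :
    ((f x ^^ f (bxor x k)) ^^ (f (bxor x U) ^^ f (bxor (bxor x U) k))) = ((f zeroVec ^^ f k) ^^ (f U ^^ f (bxor U k))) := by
  have e := hT x U k zeroVec
  have h01 : decide ((0 : ZMod 2) = 1) = false := by decide
  simp only [zeroVec_bxor, hω', hU0, hUlo, hUhi, Bool.false_eq_true, if_false, zero_mul, mul_zero, add_zero, sum_const_zero, h01,
    Bool.false_and, Bool.and_false, Bool.xor_false] at e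
  have key : ∀ A B : Bool, (A ^^ B) = false → B = A := by decide
  exact key _ _ e

/-- **Additivity in the free slot.**  With `U` free as above and any `V`: `Δ_{V ⊕ U, k} f(0) = Δ_{V,k} f(0) ⊕ Δ_{U,k} f(0)`. [this work] -/
theorem tq1_second_add (V k : Fin (1 + 6) → Bool) :
    ((f zeroVec ^^ f k) ^^ (f (bxor V U) ^^ f (bxor (bxor V U) k))) =
      (((f zeroVec ^^ f k) ^^ (f V ^^ f (bxor V k))) ^^ ((f zeroVec ^^ f k) ^^ (f U ^^ f (bxor U k)))) := by
  have e := tq1_second_free f h lo hi ω' hω' hT U hU0 hUlo hUhi k V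
  revert e
  cases f zeroVec <;> cases f k <;> cases f V <;> cases f (bxor V k) <;> cases f (bxor V U) <;> cases f (bxor (bxor V U) k) <;>
    cases f U <;> cases f (bxor U k) <;> decide

/-- **A free derivative with vanishing second differences is constant**: if `Δ_{U, e_m} f(0) = 0` for every coordinate `m`, then
`f(s ⊕ U) = f(s) ⊕ f(0) ⊕ f(U)` for all `s`. [this work] -/
theorem tq1_deriv_const (hz : ∀ m : Fin (1 + 6), ((f zeroVec ^^ f (fun l => decide (l = m))) ^^ (f U ^^ f (bxor U (fun l => decide (l = m))))) = false) :
    ∀ s, f (bxor s U) = ((f s ^^ f zeroVec) ^^ f U) := by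
  have hc := tq1_const_of_units (fun s => f s ^^ f (bxor s U)) (fun x j => by
    have e := tq1_second_free f h lo hi ω' hω' hT U hU0 hUlo hUhi (fun l => decide (l = j)) x
    rw [hz j] at e
    show (f (bxor x (fun l => decide (l = j))) ^^ f (bxor (bxor x (fun l => decide (l = j))) U)) = (f x ^^ f (bxor x U))
    rw [show bxor (bxor x (fun l => decide (l = j))) U = bxor (bxor x U) (fun l => decide (l = j)) from by
      rw [iw_bxor_assoc, iw_bxor_assoc, bxor_comm U]]
    revert e
    cases f x <;> cases f (bxor x fun l => decide (l = j)) <;> cases f (bxor x U) <;>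
      cases f (bxor (bxor x U) fun l => decide (l = j)) <;> decide)
  intro s
  have e := hc s
  simp only [zeroVec_bxor] at e
  revert e
  cases f s <;> cases f (bxor s U) <;> cases f zeroVec <;> cases f U <;> decide

end Cells

/-- **A flipping translation halves**: if `f(s ⊕ U) = ¬ f(s)` for all `s` on `1 + 6` bits then `f` has exactly `64` ones. [folklore] -/
theorem tq1_flip_card (f : (Fin (1 + 6) → Bool) → Bool) (U : Fin (1 + 6) → Bool) (hflip : ∀ s, f (bxor s U) = !f s) :
    #(univ.filter fun y : Fin (1 + 6) → Bool => f y = true) = 64 := by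
  have e := (tce_half (univ : Finset (Fin (1 + 6) → Bool)) U f (fun x _ => mem_univ _) (fun x _ => hflip x)).1
  rw [card_univ, Fintype.card_fun, Fintype.card_bool, Fintype.card_fin] at e
  norm_num at e
  omega

end Summit.QuantumAdvantage.QuantumAdvantage.Theorems.CubicForrelation.NearExactIsExact
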